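import Mathlib

/-!
# The family `L′_k ⊂ M_{3k}(ℂ)`: an irreducible space of nilpotent matrices of dimension `≥ k²` and nil-index `2k+1`

Negative lane of crux `GrenetZeon.DualUnipotentThreeHalves` (item `stmt-ValiantsHypothesis-24318`); Mathlib only; closes
nothing and proves nothing about the `3/2` rung, `per_n` or VP ≠ VNP.  This file constructs the witness family used by
`ThinWildFalse.lean` (`¬ ThinWild`, `¬ ThinWildFat`, «cheap index mass is not reachable by conjugation»):

  `L′_k = { N(A, c, t) = S ⊗ A + c·(R ⊗ 1_k) − t·(E₂₃ ⊗ J_k) : A ∈ M_k(ℂ), c, t ∈ ℂ }`,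

`S = E₁₂ + E₂₃`, `R = E₂₁ − E₃₂`, `J_k` the nilpotent Jordan block — a two-parameter fattening of the cube-zero template
`S ⊗ 𝒜 + R ⊗ ℬ` of Mathes–Omladič–Radjavi (Linear Algebra Appl. 149 (1991) 215–225, §5; held as
`paper:doi-10-1016-0024-3795-91-90335-t`).  Index type `(Fin k ⊕ Fin k) ⊕ Fin k` = blocks `1, 3 | 2`; in this bipartite
splitting `N = [[0, X], [Y, 0]]` with `X = [A ; −c·1]`, `Y = [c·1 , A − t·J]`, and the return map is `Y·X = c·t·J_k`.

## Contents
* `sh`, `J`, `J_pow_self`, `J_pow_pred_mulVec_apply_zero` — the shift / Jordan block, `J^k = 0`, `J^{k−1} ≠ 0`;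
* `X`, `Y`, `N`, `Y_mul_X`, `N_pow_even`, `N_pow_odd`, `N_pow_eq_zero`, `isNilpotent_N` — `N^{2k+1} = 0`;
* `vec3`, `N_mulVec` — the action: block 1 ← `A·v`, block 3 ← `−c·v`, block 2 ← `c·u + (A − tJ)·w`;
* `N0_pow_ne_zero` — `N(0,1,1)^{2k} ≠ 0`;
* `fam`, `L`, `L_nilpotent`, `L_pow_ne_zero`, `sq_le_finrank_L` — the space, `dim ≥ k²`;
* `L_irreducible` — a subspace of `ℂ^{3k}` invariant under all of `L′_k` is `⊥` or `⊤` (moves `S ⊗ 1`, `R ⊗ 1`, `S ⊗ A`).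
-/

set_option linter.dupNamespace false
set_option autoImplicit false

namespace Summit.ValiantsHypothesis.ValiantsHypothesis.Theorems.DualUnipotentThreeHalvesNegative.ThinWild

open Matrix

/-! ## The shift and its matrix `J_k` -/

/-- The (nilpotent) left shift on `Fin k → ℂ`: `(sh v) i = v (i+1)`, `0` in the last coordinate. -/
def sh (k : ℕ) : (Fin k → ℂ) →ₗ[ℂ] (Fin k → ℂ) where
  toFun v i := if h : (i : ℕ) + 1 < k then v ⟨i + 1, h⟩ else 0
  map_add' v w := by
    ext i
    simp only [Pi.add_apply]
    split_ifs <;> simp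
  map_smul' a v := by
    ext i
    simp only [Pi.smul_apply, smul_eq_mul, RingHom.id_apply]
    split_ifs <;> simp

/-- Unfolding lemma for `sh`. -/
theorem sh_apply (k : ℕ) (v : Fin k → ℂ) (i : Fin k) :
    sh k v i = if h : (i : ℕ) + 1 < k then v ⟨i + 1, h⟩ else 0 := rfl

/-- Iterated shift: `(sh^p v) i = v (i+p)` (or `0` past the end). -/
theorem sh_pow_apply (k p : ℕ) (v : Fin k → ℂ) (i : Fin k) :
    ((sh k) ^ p) v i = if h : (i : ℕ) + p < k then v ⟨i + p, h⟩ else 0 := by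
  induction p generalizing i with
  | zero => simp
  | succ p ih =>
    rw [pow_succ', Module.End.mul_apply, sh_apply]
    by_cases h1 : (i : ℕ) + 1 < k
    · rw [dif_pos h1, ih]
      by_cases h2 : (i : ℕ) + (p + 1) < k
      · have h3 : ((⟨(i : ℕ) + 1, h1⟩ : Fin k) : ℕ) + p < k := by simp; omega
        rw [dif_pos h3, dif_pos h2]
        congr 1
        ext
        simp
        omega
      · have h3 : ¬ ((⟨(i : ℕ) + 1, h1⟩ : Fin k) : ℕ) + p < k := by simp; omega
        rw [dif_neg h3, dif_neg h2]
    · rw [dif_neg h1, dif_neg (by omega)]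

/-- `sh^k = 0`. -/
theorem sh_pow_self (k : ℕ) : (sh k) ^ k = 0 := by
  refine LinearMap.ext fun v => funext fun i => ?_
  rw [sh_pow_apply, LinearMap.zero_apply, Pi.zero_apply, dif_neg (by omega)]

/-- The nilpotent Jordan block `J_k` (matrix of the shift). -/
noncomputable def J (k : ℕ) : Matrix (Fin k) (Fin k) ℂ := LinearMap.toMatrix' (sh k)

/-- Powers of `J_k` are the matrices of the iterated shift. -/
theorem J_pow (k p : ℕ) : J k ^ p = LinearMap.toMatrix' ((sh k) ^ p) := by
  induction p with
  | zero => simp [J]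
  | succ p ih => rw [pow_succ, ih, pow_succ, LinearMap.toMatrix'_mul, J]

/-- `J_k^k = 0`. -/
theorem J_pow_self (k : ℕ) : J k ^ k = 0 := by
  rw [J_pow, sh_pow_self, map_zero]

/-- `J_k^p` acts as the iterated shift. -/
theorem J_pow_mulVec (k p : ℕ) (v : Fin k → ℂ) : J k ^ p *ᵥ v = ((sh k) ^ p) v := by
  rw [J_pow, LinearMap.toMatrix'_mulVec]

/-- `J_k^{k-1} ≠ 0`: it sends the all-ones vector to `e_0`. -/
theorem J_pow_pred_mulVec_apply_zero (k : ℕ) (hk : 1 ≤ k) :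
    (J k ^ (k - 1) *ᵥ fun _ => (1 : ℂ)) ⟨0, by omega⟩ = 1 := by
  rw [J_pow_mulVec, sh_pow_apply, dif_pos (by simp only []; omega)]

/-! ## The family `N(A, c, t)` on `(ℂ^k ⊕ ℂ^k) ⊕ ℂ^k` (blocks 1, 3 | 2) -/

/-- Index type of the family: blocks `1` and `3` (left summand), block `2` (right summand). -/
abbrev ι (k : ℕ) : Type := (Fin k ⊕ Fin k) ⊕ Fin k

/-- `X(A, c) = [A ; −c·1]` (block 2 → blocks 1, 3). -/
noncomputable def X (k : ℕ) (A : Matrix (Fin k) (Fin k) ℂ) (c : ℂ) : Matrix (Fin k ⊕ Fin k) (Fin k) ℂ :=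
  fromRows A (-(c • (1 : Matrix (Fin k) (Fin k) ℂ)))

/-- `Y(A, c, t) = [c·1 , A − t·J]` (blocks 1, 3 → block 2). -/
noncomputable def Y (k : ℕ) (A : Matrix (Fin k) (Fin k) ℂ) (c t : ℂ) : Matrix (Fin k) (Fin k ⊕ Fin k) ℂ :=
  fromCols (c • (1 : Matrix (Fin k) (Fin k) ℂ)) (A - t • J k)

/-- `N(A, c, t) = S ⊗ A + c·(R ⊗ 1) − t·(E₂₃ ⊗ J)` written as the bipartite block matrix `[[0, X], [Y, 0]]`. -/
noncomputable def N (k : ℕ) (A : Matrix (Fin k) (Fin k) ℂ) (c t : ℂ) : Matrix (ι k) (ι k) ℂ :=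
  fromBlocks 0 (X k A c) (Y k A c t) 0

/-- The return product `Y·X = c·t·J` — the only way back from blocks 1, 3 to block 2 is nilpotent. -/
theorem Y_mul_X (k : ℕ) (A : Matrix (Fin k) (Fin k) ℂ) (c t : ℂ) : Y k A c t * X k A c = (c * t) • J k := by
  rw [Y, X, fromCols_mul_fromRows]
  rw [Matrix.mul_neg, Matrix.mul_smul, Matrix.mul_one, Matrix.smul_mul, Matrix.one_mul, smul_sub, mul_smul]
  abel

/-- `N² = [[XY, 0], [0, YX]]`. -/
theorem N_sq (k : ℕ) (A : Matrix (Fin k) (Fin k) ℂ) (c t : ℂ) :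
    N k A c t ^ 2 = fromBlocks (X k A c * Y k A c t) 0 0 (Y k A c t * X k A c) := by
  rw [pow_two, N, fromBlocks_multiply]
  simp

/-- Even powers: `N^{2j} = [[(XY)^j, 0], [0, (YX)^j]]`. -/
theorem N_pow_even (k : ℕ) (A : Matrix (Fin k) (Fin k) ℂ) (c t : ℂ) (j : ℕ) :
    N k A c t ^ (2 * j) = fromBlocks ((X k A c * Y k A c t) ^ j) 0 0 ((Y k A c t * X k A c) ^ j) := by
  induction j with
  | zero => simp [← fromBlocks_one]
  | succ j ih =>
    rw [show 2 * (j + 1) = 2 * j + 2 by ring, pow_add, ih, N_sq, fromBlocks_multiply]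
    simp [pow_succ]

/-- `(XY)^j X = X (YX)^j`. -/
theorem XY_pow_mul_X (k : ℕ) (A : Matrix (Fin k) (Fin k) ℂ) (c t : ℂ) (j : ℕ) :
    (X k A c * Y k A c t) ^ j * X k A c = X k A c * (Y k A c t * X k A c) ^ j := by
  induction j with
  | zero => simp
  | succ j ih =>
    calc (X k A c * Y k A c t) ^ (j + 1) * X k A c
        = (X k A c * Y k A c t) ^ j * (X k A c * Y k A c t) * X k A c := by rw [pow_succ]
      _ = ((X k A c * Y k A c t) ^ j * X k A c) * (Y k A c t * X k A c) := by simp only [Matrix.mul_assoc]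
      _ = X k A c * (Y k A c t * X k A c) ^ j * (Y k A c t * X k A c) := by rw [ih]
      _ = X k A c * (Y k A c t * X k A c) ^ (j + 1) := by rw [pow_succ, Matrix.mul_assoc]

/-- Odd powers: `N^{2j+1} = [[0, (XY)^j X], [(YX)^j Y, 0]]`. -/
theorem N_pow_odd (k : ℕ) (A : Matrix (Fin k) (Fin k) ℂ) (c t : ℂ) (j : ℕ) :
    N k A c t ^ (2 * j + 1) =
      fromBlocks 0 ((X k A c * Y k A c t) ^ j * X k A c) ((Y k A c t * X k A c) ^ j * Y k A c t) 0 := by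
  rw [pow_succ, N_pow_even, N, fromBlocks_multiply]
  simp

/-- **Every member of the family is nilpotent**, of index `≤ 2k+1`. -/
theorem N_pow_eq_zero (k : ℕ) (A : Matrix (Fin k) (Fin k) ℂ) (c t : ℂ) : N k A c t ^ (2 * k + 1) = 0 := by
  rw [N_pow_odd, XY_pow_mul_X, Y_mul_X, smul_pow, J_pow_self]
  simp

/-- Every `N(A, c, t)` is nilpotent. -/
theorem isNilpotent_N (k : ℕ) (A : Matrix (Fin k) (Fin k) ℂ) (c t : ℂ) : IsNilpotent (N k A c t) :=
  ⟨2 * k + 1, N_pow_eq_zero k A c t⟩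

/-! ## Action on vectors -/

/-- A vector with block components `u` (block 1), `w` (block 3), `v` (block 2). -/
def vec3 {k : ℕ} (u w v : Fin k → ℂ) : ι k → ℂ := Sum.elim (Sum.elim u w) v

/-- `vec3` is additive. -/
theorem vec3_add {k : ℕ} (u w v u' w' v' : Fin k → ℂ) :
    vec3 u w v + vec3 u' w' v' = vec3 (u + u') (w + w') (v + v') := by
  ext x; rcases x with ((x|x)|x) <;> rfl

/-- Every vector is a `vec3` of its three block components. -/
theorem vec3_eq (k : ℕ) (x : ι k → ℂ) :
    x = vec3 (fun i => x (Sum.inl (Sum.inl i))) (fun i => x (Sum.inl (Sum.inr i))) (fun i => x (Sum.inr i)) := by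
  ext y; rcases y with ((y|y)|y) <;> rfl

/-- `vec3 u w v = 0` iff all three components vanish. -/
theorem vec3_eq_zero_iff {k : ℕ} (u w v : Fin k → ℂ) : vec3 u w v = 0 ↔ u = 0 ∧ w = 0 ∧ v = 0 := by
  constructor
  · intro h
    refine ⟨?_, ?_, ?_⟩
    · ext i; exact congr_fun h (Sum.inl (Sum.inl i))
    · ext i; exact congr_fun h (Sum.inl (Sum.inr i))
    · ext i; exact congr_fun h (Sum.inr i)
  · rintro ⟨rfl, rfl, rfl⟩
    ext x; rcases x with ((x|x)|x) <;> rfl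

/-- **The action of `N(A, c, t)`:** block 1 ← `A·v`, block 3 ← `−c·v`, block 2 ← `c·u + (A − tJ)·w`. -/
theorem N_mulVec (k : ℕ) (A : Matrix (Fin k) (Fin k) ℂ) (c t : ℂ) (u w v : Fin k → ℂ) :
    N k A c t *ᵥ vec3 u w v = vec3 (A *ᵥ v) (-(c • v)) (c • u + (A - t • J k) *ᵥ w) := by
  rw [N, vec3, fromBlocks_mulVec]
  simp only [Sum.elim_comp_inl, Sum.elim_comp_inr, Matrix.zero_mulVec, zero_add, add_zero, X, Y,
    fromRows_mulVec, fromCols_mulVec_sumElim, Matrix.neg_mulVec, Matrix.smul_mulVec, Matrix.one_mulVec]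
  rfl

/-! ## `N₀ = N(0, 1, 1)` has `N₀^{2k} ≠ 0` (nil-index exactly `2k+1`) -/

/-- Action of `X(A, c)`. -/
theorem X_mulVec (k : ℕ) (A : Matrix (Fin k) (Fin k) ℂ) (c : ℂ) (z : Fin k → ℂ) :
    X k A c *ᵥ z = Sum.elim (A *ᵥ z) (-(c • z)) := by
  rw [X, fromRows_mulVec, Matrix.neg_mulVec, Matrix.smul_mulVec, Matrix.one_mulVec]

/-- Action of `Y(A, c, t)`. -/
theorem Y_mulVec (k : ℕ) (A : Matrix (Fin k) (Fin k) ℂ) (c t : ℂ) (u w : Fin k → ℂ) :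
    Y k A c t *ᵥ Sum.elim u w = c • u + (A - t • J k) *ᵥ w := by
  rw [Y, fromCols_mulVec_sumElim, Matrix.smul_mulVec, Matrix.one_mulVec]

/-- `N₀^{2k}` sends `(𝟙, 0 | 0)` to `(0, −J^{k−1}𝟙 | 0) ≠ 0`. -/
theorem N0_pow_ne_zero (k : ℕ) (hk : 1 ≤ k) : N k 0 1 1 ^ (2 * k) ≠ 0 := by
  obtain ⟨k', rfl⟩ : ∃ k', k = k' + 1 := ⟨k - 1, by omega⟩
  intro h
  have hv := congr_arg (fun M => M *ᵥ vec3 (fun _ => (1 : ℂ)) 0 0) h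
  simp only [Matrix.zero_mulVec] at hv
  rw [N_pow_even, vec3, fromBlocks_mulVec] at hv
  simp only [Sum.elim_comp_inl, Sum.elim_comp_inr, Matrix.zero_mulVec, Matrix.mulVec_zero, add_zero] at hv
  have hP : (X (k' + 1) 0 1 * Y (k' + 1) 0 1 1) ^ (k' + 1) =
      X (k' + 1) 0 1 * (Y (k' + 1) 0 1 1 * X (k' + 1) 0 1) ^ k' * Y (k' + 1) 0 1 1 := by
    rw [pow_succ, ← Matrix.mul_assoc, XY_pow_mul_X]
  rw [hP, Y_mul_X, one_mul, one_smul, ← Matrix.mulVec_mulVec, ← Matrix.mulVec_mulVec, Y_mulVec,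
    Matrix.mulVec_zero, add_zero, one_smul, X_mulVec] at hv
  have h3 := congr_fun hv (Sum.inl (Sum.inr ⟨0, by omega⟩))
  simp only [Sum.elim_inl, Sum.elim_inr, Pi.zero_apply, Pi.neg_apply, Pi.smul_apply, neg_eq_zero,
    smul_eq_mul, one_mul] at h3
  have h1 := J_pow_pred_mulVec_apply_zero (k' + 1) hk
  rw [Nat.add_sub_cancel] at h1
  rw [h1] at h3
  exact one_ne_zero h3

/-! ## The space `L′_k` and its irreducibility -/

/-- `X` is additive in `(A, c)`. -/
theorem X_add (k : ℕ) (A A' : Matrix (Fin k) (Fin k) ℂ) (c c' : ℂ) :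
    X k (A + A') (c + c') = X k A c + X k A' c' := by
  ext i j; rcases i with i | i <;> simp [X, fromRows, add_smul, Matrix.add_apply, add_comm]

/-- `X` is homogeneous in `(A, c)`. -/
theorem X_smul (k : ℕ) (a : ℂ) (A : Matrix (Fin k) (Fin k) ℂ) (c : ℂ) :
    X k (a • A) (a * c) = a • X k A c := by
  ext i j; rcases i with i | i <;> simp [X, fromRows, mul_smul, Matrix.smul_apply]

/-- `Y` is additive in `(A, c, t)`. -/
theorem Y_add (k : ℕ) (A A' : Matrix (Fin k) (Fin k) ℂ) (c c' t t' : ℂ) :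
    Y k (A + A') (c + c') (t + t') = Y k A c t + Y k A' c' t' := by
  ext i j; rcases j with j | j <;>
    simp [Y, fromCols, add_smul, Matrix.add_apply, Matrix.sub_apply, add_sub_add_comm]

/-- `Y` is homogeneous in `(A, c, t)`. -/
theorem Y_smul (k : ℕ) (a : ℂ) (A : Matrix (Fin k) (Fin k) ℂ) (c t : ℂ) :
    Y k (a • A) (a * c) (a * t) = a • Y k A c t := by
  ext i j; rcases j with j | j <;> simp [Y, fromCols, mul_smul, Matrix.smul_apply, Matrix.sub_apply, mul_sub]

/-- The linear parametrisation `(A, c, t) ↦ N(A, c, t)`. -/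
noncomputable def fam (k : ℕ) : (Matrix (Fin k) (Fin k) ℂ × ℂ × ℂ) →ₗ[ℂ] Matrix (ι k) (ι k) ℂ where
  toFun p := N k p.1 p.2.1 p.2.2
  map_add' p q := by
    simp only [Prod.fst_add, Prod.snd_add, N]
    rw [X_add, Y_add, fromBlocks_add]
    simp
  map_smul' a p := by
    simp only [Prod.smul_fst, Prod.smul_snd, smul_eq_mul, RingHom.id_apply, N]
    rw [X_smul, Y_smul, fromBlocks_smul]
    simp

/-- **The space `L′_k`**: all `N(A, c, t)`, `A ∈ M_k(ℂ)`, `c, t ∈ ℂ`. -/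
noncomputable def L (k : ℕ) : Submodule ℂ (Matrix (ι k) (ι k) ℂ) := LinearMap.range (fam k)

/-- Membership in `L′_k`. -/
theorem mem_L_iff (k : ℕ) (M : Matrix (ι k) (ι k) ℂ) : M ∈ L k ↔ ∃ A c t, M = N k A c t := by
  constructor
  · rintro ⟨⟨A, c, t⟩, rfl⟩
    exact ⟨A, c, t, rfl⟩
  · rintro ⟨A, c, t, rfl⟩
    exact ⟨⟨A, c, t⟩, rfl⟩

/-- `N(A, c, t) ∈ L′_k`. -/
theorem N_mem_L (k : ℕ) (A : Matrix (Fin k) (Fin k) ℂ) (c t : ℂ) : N k A c t ∈ L k :=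
  (mem_L_iff k _).2 ⟨A, c, t, rfl⟩

/-- Every member of `L′_k` is nilpotent. -/
theorem L_nilpotent (k : ℕ) : ∀ M ∈ L k, IsNilpotent M := by
  intro M hM
  obtain ⟨A, c, t, rfl⟩ := (mem_L_iff k M).1 hM
  exact isNilpotent_N k A c t

/-- `L′_k` contains an element of nil-index `> 2k`. -/
theorem L_pow_ne_zero (k : ℕ) (hk : 1 ≤ k) : ∃ M ∈ L k, M ^ (2 * k) ≠ 0 :=
  ⟨N k 0 1 1, N_mem_L k 0 1 1, N0_pow_ne_zero k hk⟩

/-- `dim L′_k ≥ k²` (the `A`-part alone is an injective image of `M_k(ℂ)`). -/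
theorem sq_le_finrank_L (k : ℕ) : k ^ 2 ≤ Module.finrank ℂ (L k) := by
  let g : Matrix (Fin k) (Fin k) ℂ →ₗ[ℂ] Matrix (ι k) (ι k) ℂ := (fam k).comp (LinearMap.inl ℂ _ _)
  have hg : Function.Injective g := by
    intro A A' h
    ext i j
    have := congr_fun (congr_fun h (Sum.inl (Sum.inl i))) (Sum.inr j)
    simpa [g, fam, N, X, fromBlocks_apply₁₂, fromRows_apply_inl] using this
  have hrange : LinearMap.range g ≤ L k := by
    rintro M ⟨A, rfl⟩
    exact ⟨(A, 0, 0), rfl⟩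
  have h1 := Submodule.finrank_mono hrange
  rw [LinearMap.finrank_range_of_inj hg, Module.finrank_matrix] at h1
  simpa [pow_two] using h1

/-- **`L′_k` is irreducible:** a subspace invariant under every member is `⊥` or `⊤`. -/
theorem L_irreducible (k : ℕ) (W : Submodule ℂ (ι k → ℂ))
    (hW : ∀ M ∈ L k, ∀ x ∈ W, M *ᵥ x ∈ W) : W = ⊥ ∨ W = ⊤ := by
  classical
  by_cases hbot : W = ⊥
  · exact Or.inl hbot
  right
  obtain ⟨x, hxW, hx0⟩ := (Submodule.ne_bot_iff W).1 hbot
  obtain ⟨u, w, v, rfl⟩ : ∃ u w v : Fin k → ℂ, x = vec3 u w v := ⟨_, _, _, vec3_eq k x⟩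
  have hN : ∀ (A : Matrix (Fin k) (Fin k) ℂ) (c t : ℂ) (y : ι k → ℂ), y ∈ W → N k A c t *ᵥ y ∈ W :=
    fun A c t y hy => hW _ (N_mem_L k A c t) y hy
  -- the three moves: `S ⊗ 1`, `R ⊗ 1`, `S ⊗ A`
  have hI : ∀ u w v : Fin k → ℂ, vec3 u w v ∈ W → vec3 v 0 w ∈ W := by
    intro u w v h
    have h' := hN 1 0 0 _ h
    rw [N_mulVec] at h'
    simpa using h'
  have hR : ∀ u w v : Fin k → ℂ, vec3 u w v ∈ W → vec3 0 (-v) u ∈ W := by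
    intro u w v h
    have h' := hN 0 1 0 _ h
    rw [N_mulVec] at h'
    simpa using h'
  have hA : ∀ (A : Matrix (Fin k) (Fin k) ℂ) (u w v : Fin k → ℂ), vec3 u w v ∈ W →
      vec3 (A *ᵥ v) 0 (A *ᵥ w) ∈ W := by
    intro A u w v h
    have h' := hN A 0 0 _ h
    rw [N_mulVec] at h'
    simpa using h'
  -- Step 1: a non-zero vector supported on block 1
  have step1 : ∃ u' : Fin k → ℂ, u' ≠ 0 ∧ vec3 u' 0 0 ∈ W := by
    by_cases hw : w = 0
    · subst hw
      by_cases hv : v = 0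
      · subst hv
        refine ⟨u, ?_, hxW⟩
        rintro rfl
        exact hx0 ((vec3_eq_zero_iff 0 0 0).2 ⟨rfl, rfl, rfl⟩)
      · exact ⟨v, hv, hI u 0 v hxW⟩
    · exact ⟨w, hw, hI v 0 w (hI u w v hxW)⟩
  obtain ⟨u', hu', hu'W⟩ := step1
  -- Step 2: all of block 1, then blocks 2 and 3
  have blk1 : ∀ z : Fin k → ℂ, vec3 z 0 0 ∈ W := by
    intro z
    obtain ⟨j, hj⟩ : ∃ j, u' j ≠ 0 := Function.ne_iff.mp hu'
    have h1 : vec3 0 0 u' ∈ W := by simpa using hR u' 0 0 hu'W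
    let A : Matrix (Fin k) (Fin k) ℂ := Matrix.of fun a b => if b = j then z a * (u' j)⁻¹ else 0
    have hAu : A *ᵥ u' = z := by
      ext a
      simp [A, Matrix.mulVec, dotProduct, hj]
    have h2 := hA A 0 0 u' h1
    rwa [hAu, Matrix.mulVec_zero] at h2
  have blk2 : ∀ z : Fin k → ℂ, vec3 0 0 z ∈ W := fun z => by simpa using hR z 0 0 (blk1 z)
  have blk3 : ∀ z : Fin k → ℂ, vec3 0 z 0 ∈ W := fun z => by simpa using hR 0 0 (-z) (blk2 (-z))
  rw [eq_top_iff]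
  intro y _
  rw [vec3_eq k y]
  have hsplit : ∀ a b d : Fin k → ℂ, vec3 a b d = vec3 a 0 0 + vec3 0 b 0 + vec3 0 0 d := by
    intro a b d
    rw [vec3_add, vec3_add]
    simp
  rw [hsplit]
  exact W.add_mem (W.add_mem (blk1 _) (blk3 _)) (blk2 _)

end Summit.ValiantsHypothesis.ValiantsHypothesis.Theorems.DualUnipotentThreeHalvesNegative.ThinWild
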